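import Summits.ResolutionOfSingularities.ResolutionOfSingularities.Theorems.HomologicalConductorNoZenoBirthDefs
import Literature.RingTheory.FittingIdeal.Basic
import Literature.RingTheory.CohomologyAnnihilator.Localization
import Mathlib.RingTheory.Kaehler.Basic
import HarnessLib

/-!
# Crux `NoZenoR` / `NoZeno` (stmt-ResolutionOfSingularities-19943 / -16483) — THE KÄHLER-DIFFERENT FLOOR ALONG THE TOWER (g3′)

Route `ResolutionOfSingularities/HomologicalConductor`, W4.4 chain, gate g3′ of plan-1's V32-RECIPE (CHAIN v25 (ρ39b)–(ρ39d),
(ρ39c″) 2026-08-27T16:54:58Z).  After the FACT desk's ruling F-89a′ (the classical-Jacobian form of Iyengar–Takahashi 2016 Ex. 3.2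
was BOUNCED at review — false over imperfect fields — and replaced by the one-summand KÄHLER-DIFFERENT form of Thm 1.2 / 3.8,
valid over every field), the thread conjunct of record is res-L0-w44-plan-1's `Sig.JacobianFloorK`
(`L/res-L0-w44-plan-1/JprimeThread.lean` 0f1fb0ab2012c387); this file is its TREE BRIDGE (β′):

* `isLocalization_of_fractions` — a ring of fractions with unit denominators is a localisation (this seat);
* `mem_ca_of_mem_cohomologyAnnihilatorOfDegree`, `mem_ca_tower_of_mem_cohomologyAnnihilatorOfDegree` — FACT-FREE CORE: for a
  finitely generated model `B ≤ T_m` over which the stage consists of fractions with unit denominators, `caⁿ(B) ⊆ ca(T_m)`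
  elementwise (Iyengar–Takahashi 2014 Lemma 2.10(1) + unfolding; pattern of res-L0-w44-idea-2's `mem_ca_of_mem_floor`);
* `mem_ca_tower_of_mem_kaehlerDifferent` (elementwise) and **`jacobianFloorK_of_fact (hJ) : <Sig.JacobianFloorK unfolded>`** —
  CONDITIONAL on the named fact F-89a′ only (hypothesis `hJ` = plan-1's `FactJPrime` = res-D-lit-1's Thm 3.8 rendering VERBATIM at
  universe `Type`): for every stage `T_m`, every finitely generated normal model `B ≤ T_m` of Krull dimension `3` with unit-denominator
  fractions (supplied for `m ≥ 1` by `…Theorems.NoZeno.StagePresentation`), every Noether normalisation `S → ↥B` (noetherian,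
  `∃ n, caⁿ(S) = ⊤`, module-finite, injective) and every `x ∈ Fitt₀(Ω[↥B⁄S])`: `(x : K) ∈ ca (T_m)`; the conclusion of
  `jacobianFloorK_of_fact` is `Sig.JacobianFloorK`'s text verbatim, so the v32 recipe's `JacobianFloor.jacobianFloorK_of_fact hF2.2`
  elaborates against the skeleton's `Sig.JacobianFloorK` by unfolding;
* `jacobianFloorK_of_fact'` — the same from the AFFINE wording of (J′) (plan-1's `JprimeText.lean` b062425e129e760b).
OURS (cell res-hironaka): AI-produced and kernel-checked, weaker than expert review; nothing here is a statement of the manuscript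
under review (Hironaka 2017); def-free.
-/

noncomputable section

-- single-problem summit: the doubled namespace component `ResolutionOfSingularities` is forced
set_option linter.dupNamespace false

namespace Summit.ResolutionOfSingularities.ResolutionOfSingularities.Theorems.NoZeno.JacobianFloor

open Summit.ResolutionOfSingularities.ResolutionOfSingularities.Theses.HomologicalConductor
open Summit.ResolutionOfSingularities.ResolutionOfSingularities.Theorems.NoZeno.Birth
open Literature.RingTheory.FittingIdeal Literature.RingTheory.CohomologyAnnihilator

variable {k K : Type} [Field k] [Field K] [Algebra k K]

/-! ## §1 A ring of fractions with unit denominators is a localisation -/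

omit [Algebra k K] in
/-- If `B → T` is injective and every `s : T` is `a / t` with `a, t ∈ B` and `t` a unit of `T`, then `T` is the localisation of
`B` at the `T`-units of `B`. [folklore] -/
theorem isLocalization_of_fractions {B T : Type} [CommRing B] [CommRing T] [Algebra B T]
    (hinj : Function.Injective (algebraMap B T))
    (hfrac : ∀ s : T, ∃ a t : B, IsUnit (algebraMap B T t) ∧ s * algebraMap B T t = algebraMap B T a) :
    IsLocalization ((IsUnit.submonoid T).comap (algebraMap B T)) T where
  map_units y := y.2
  surj s := by
    obtain ⟨a, t, ht, h⟩ := hfrac s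
    exact ⟨⟨a, ⟨t, ht⟩⟩, h⟩
  exists_of_eq {a b} h := ⟨1, by simpa using hinj h⟩

/-! ## §2 Degree-`n` cohomology annihilators of a model localise into the route's `ca` of the stage (fact-free core) -/

/-- **From the degree-`n` annihilator to the route's `ca`** (pattern of res-L0-w44-idea-2's `mem_ca_of_mem_floor`): an element of
`caⁿ(B)` lies in `ca B` (the degree `n` witnesses the `∃ n`). [this work; unfolding] -/
theorem mem_ca_of_mem_cohomologyAnnihilatorOfDegree (B : Subalgebra k K) (n : ℕ) (x : ↥B)
    (hx : x ∈ cohomologyAnnihilatorOfDegree ↥B n) : (x : K) ∈ ca B := by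
  refine ⟨x.2, n, fun i hi M N hM hN e => ?_⟩
  have hx' := (mem_cohomologyAnnihilatorOfDegree_iff (R := ↥B) (n := n)).1 hx
  simpa using hx' i hi M N hM hN e

/-- **MODEL-TO-STAGE TRANSPORT (fact-free).**  If `B ≤ T_m` is a finitely generated `k`-subalgebra over which the stage `T_m`
consists of fractions with `T_m`-unit denominators (e.g. the normal model of `StagePresentation.exists_fg_normal_presentation`),
then every element of `caⁿ(B)` lies in the route's `ca (T_m)`: `T_m` is a localisation of the noetherian ring `B`
(`isLocalization_of_fractions`), `caⁿ(B)·T_m ⊆ caⁿ(T_m)` (Iyengar–Takahashi 2014 Lemma 2.10(1), tree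
`map_cohomologyAnnihilatorOfDegree_le_of_isLocalization`), and `caⁿ(T_m) ⊆ ca(T_m)`. [cite: IyengarTakahashi2014, Lemma 2.10] -/
theorem mem_ca_tower_of_mem_cohomologyAnnihilatorOfDegree (O : ValuationSubring K) (A : Subalgebra k K) (m : ℕ)
    (B : Subalgebra k K) (hBfg : B.FG) (hBT : B ≤ tower O A m)
    (hfrac : ∀ s ∈ tower O A m, ∃ a ∈ B, ∃ t ∈ B, t ≠ 0 ∧ t⁻¹ ∈ tower O A m ∧ s = a * t⁻¹)
    (n : ℕ) (x : ↥B) (hx : x ∈ cohomologyAnnihilatorOfDegree ↥B n) :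
    ((x : K)) ∈ ca (tower O A m) := by
  haveI : Algebra.FiniteType k ↥B := B.fg_iff_finiteType.mp hBfg
  haveI : IsNoetherianRing ↥B := Algebra.FiniteType.isNoetherianRing k ↥B
  -- `T_m` as a `B`-algebra: the localisation at the `T_m`-units of `B`
  letI alg : Algebra ↥B ↥(tower O A m) := (Subalgebra.inclusion hBT).toRingHom.toAlgebra
  have hinj : Function.Injective (algebraMap ↥B ↥(tower O A m)) := Subalgebra.inclusion_injective hBT
  have hfrac' : ∀ s : ↥(tower O A m), ∃ a t : ↥B, IsUnit (algebraMap ↥B ↥(tower O A m) t) ∧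
      s * algebraMap ↥B ↥(tower O A m) t = algebraMap ↥B ↥(tower O A m) a := by
    intro s
    obtain ⟨a, ha, t, ht, ht0, htinv, hs⟩ := hfrac s s.2
    refine ⟨⟨a, ha⟩, ⟨t, ht⟩, ?_, ?_⟩
    · refine IsUnit.of_mul_eq_one ⟨t⁻¹, htinv⟩ (Subtype.ext ?_)
      show t * t⁻¹ = 1
      exact mul_inv_cancel₀ ht0
    · apply Subtype.ext
      show (s : K) * t = a
      rw [hs, inv_mul_cancel_right₀ ht0]
  haveI hloc : IsLocalization ((IsUnit.submonoid ↥(tower O A m)).comap (algebraMap ↥B ↥(tower O A m)))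
      ↥(tower O A m) := isLocalization_of_fractions hinj hfrac'
  have hmap := map_cohomologyAnnihilatorOfDegree_le_of_isLocalization
    ((IsUnit.submonoid ↥(tower O A m)).comap (algebraMap ↥B ↥(tower O A m))) ↥(tower O A m) n
  have hxT : algebraMap ↥B ↥(tower O A m) x ∈ cohomologyAnnihilatorOfDegree ↥(tower O A m) n :=
    hmap (Ideal.mem_map_of_mem _ hx)
  exact mem_ca_of_mem_cohomologyAnnihilatorOfDegree (tower O A m) n _ hxT

/-! ## §3 The Kähler-different floor along the tower from the named fact F-89a′ -/

/-- **Elementwise form** (used binders only): for a finitely generated normal model `B ≤ T_m` of Krull dimension `3` with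
unit-denominator fractions, a Noether normalisation `S → ↥B` in Iyengar–Takahashi's sense and `x ∈ Fitt₀(Ω[↥B⁄S])`, the fact
F-89a′ (hypothesis `hJ`, its text VERBATIM at universe `Type`) puts `x` in `ca⁴(↥B)`, and the fact-free core puts `(x : K)` in
`ca (T_m)`.  CONDITIONAL on the named fact only. [this work; plumbing] -/
theorem mem_ca_tower_of_mem_kaehlerDifferent (k K : Type) [Field k] [Field K] [Algebra k K]
    (hJ : ∀ (B : Type) [CommRing B] [IsNoetherianRing B] [IsDomain B], IsIntegrallyClosed B → ringKrullDim B = 3 →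
      ∀ (S : Type) [CommRing S] [IsNoetherianRing S] [Algebra S B] [Module.Finite S B],
        Function.Injective (algebraMap S B) → (∃ n : ℕ, cohomologyAnnihilatorOfDegree S n = ⊤) →
          Module.fittingIdeal B (Ω[B⁄S]) 0 ≤ cohomologyAnnihilatorOfDegree B 4)
    (O : ValuationSubring K) (A : Subalgebra k K) (m : ℕ) (B : Subalgebra k K) (hBfg : B.FG)
    (hBic : IsIntegrallyClosed ↥B) (hdim : ringKrullDim ↥B = 3) (hBT : B ≤ tower O A m)
    (hfrac : ∀ s ∈ tower O A m, ∃ a ∈ B, ∃ t ∈ B, t ≠ 0 ∧ t⁻¹ ∈ tower O A m ∧ s = a * t⁻¹)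
    (S : Type) [CommRing S] [IsNoetherianRing S] [Algebra S ↥B] [Module.Finite S ↥B]
    (hinjS : Function.Injective (algebraMap S ↥B)) (hnS : ∃ n : ℕ, cohomologyAnnihilatorOfDegree S n = ⊤)
    (x : ↥B) (hx : x ∈ Literature.RingTheory.FittingIdeal.Module.fittingIdeal ↥B (Ω[↥B⁄S]) 0) :
    (x : K) ∈ ca (tower O A m) := by
  haveI : Algebra.FiniteType k ↥B := B.fg_iff_finiteType.mp hBfg
  haveI : IsNoetherianRing ↥B := Algebra.FiniteType.isNoetherianRing k ↥B
  have h4 : x ∈ cohomologyAnnihilatorOfDegree ↥B 4 := hJ ↥B hBic hdim S hinjS hnS hx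
  exact mem_ca_tower_of_mem_cohomologyAnnihilatorOfDegree O A m B hBfg hBT hfrac 4 x h4

/-- **THE BRIDGE g3′: F-89a′ ⇒ (J′-thread)** — CONCLUSION = the text of res-L0-w44-plan-1's `Sig.JacobianFloorK`
(`JprimeThread.lean` 0f1fb0ab2012c387) UNFOLDED VERBATIM (all outer binders, including the unused crux-prefix ones, so that the
v32 skeleton's `JacobianFloor.jacobianFloorK_of_fact hF2.2 : Sig.JacobianFloorK` elaborates by `δ`-unfolding alone);
HYPOTHESIS `hJ` = the text of the named fact F-89a′ = plan-1's `FactJPrime` = res-D-lit-1's Thm 3.8 rendering VERBATIM at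
universe `Type` (Iyengar–Takahashi 2016 Thm 3.8 on ONE summand of the paper's `jac`: for a noetherian NORMAL domain `B` of Krull
dimension `3` and every Noether normalisation `S → B` — `S` noetherian with `∃ n, caⁿ(S) = ⊤`, `B` module-finite over `S`,
injective — the Kähler different `Fitt₀(Ω[B⁄S])` lies in `ca⁴(B)`).  Proof = plan-1's in-scratch `jacobianFloorK_of_fact`
through the fact-free core above.  CONDITIONAL on the named fact only. [this work; plumbing] -/
theorem jacobianFloorK_of_fact
    (hJ : ∀ (B : Type) [CommRing B] [IsNoetherianRing B] [IsDomain B], IsIntegrallyClosed B → ringKrullDim B = 3 →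
      ∀ (S : Type) [CommRing S] [IsNoetherianRing S] [Algebra S B] [Module.Finite S B],
        Function.Injective (algebraMap S B) → (∃ n : ℕ, cohomologyAnnihilatorOfDegree S n = ⊤) →
          Module.fittingIdeal B (Ω[B⁄S]) 0 ≤ cohomologyAnnihilatorOfDegree B 4) :
    ∀ (k K : Type) [Field k] [Field K] [Algebra k K] (O : ValuationSubring K) (A : Subalgebra k K),
      (∀ c : k, algebraMap k K c ∈ O) → A.FG → IsFractionRing ↥A K → A.toSubring ≤ O.toSubring →
      Algebra.trdeg k K = 3 →
      ∀ (m : ℕ) (B : Subalgebra k K), B.FG → IsIntegrallyClosed ↥B → ringKrullDim ↥B = 3 →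
        B ≤ tower O A m →
        (∀ s ∈ tower O A m, ∃ a ∈ B, ∃ t ∈ B, t ≠ 0 ∧ t⁻¹ ∈ tower O A m ∧ s = a * t⁻¹) →
        ∀ (S : Type) [CommRing S] [IsNoetherianRing S] [Algebra S ↥B] [Module.Finite S ↥B],
          Function.Injective (algebraMap S ↥B) → (∃ n : ℕ, cohomologyAnnihilatorOfDegree S n = ⊤) →
          ∀ x : ↥B, x ∈ Literature.RingTheory.FittingIdeal.Module.fittingIdeal ↥B (Ω[↥B⁄S]) 0 →
            (x : K) ∈ ca (tower O A m) :=
  fun k K _ _ _ O A _ _ _ _ _ m B hBfg hBic hdim hBT hfrac S _ _ _ _ hinjS hnS x hx =>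
    mem_ca_tower_of_mem_kaehlerDifferent k K hJ O A m B hBfg hBic hdim hBT hfrac S hinjS hnS x hx

/-- **The same from the AFFINE wording of (J′)** (res-L0-w44-plan-1's `JprimeText.lean` b062425e129e760b
`jacobianFloorKaehler_normal_dim3 k`: binders `[Algebra k B]`, `Algebra.FiniteType k B →`, `Module.Finite S B` as an explicit
hypothesis, per field `k`), again with the conclusion = `Sig.JacobianFloorK` unfolded verbatim. [this work; plumbing] -/
theorem jacobianFloorK_of_fact'
    (hJ : ∀ (k : Type) [Field k] (B : Type) [CommRing B] [IsDomain B] [Algebra k B],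
      Algebra.FiniteType k B → IsIntegrallyClosed B → ringKrullDim B = 3 →
      ∀ (S : Type) [CommRing S] [IsNoetherianRing S] [Algebra S B],
        Function.Injective (algebraMap S B) → Module.Finite S B →
        (∃ n : ℕ, cohomologyAnnihilatorOfDegree S n = ⊤) →
        Module.fittingIdeal B (Ω[B⁄S]) 0 ≤ cohomologyAnnihilatorOfDegree B 4) :
    ∀ (k K : Type) [Field k] [Field K] [Algebra k K] (O : ValuationSubring K) (A : Subalgebra k K),
      (∀ c : k, algebraMap k K c ∈ O) → A.FG → IsFractionRing ↥A K → A.toSubring ≤ O.toSubring →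
      Algebra.trdeg k K = 3 →
      ∀ (m : ℕ) (B : Subalgebra k K), B.FG → IsIntegrallyClosed ↥B → ringKrullDim ↥B = 3 →
        B ≤ tower O A m →
        (∀ s ∈ tower O A m, ∃ a ∈ B, ∃ t ∈ B, t ≠ 0 ∧ t⁻¹ ∈ tower O A m ∧ s = a * t⁻¹) →
        ∀ (S : Type) [CommRing S] [IsNoetherianRing S] [Algebra S ↥B] [Module.Finite S ↥B],
          Function.Injective (algebraMap S ↥B) → (∃ n : ℕ, cohomologyAnnihilatorOfDegree S n = ⊤) →
          ∀ x : ↥B, x ∈ Literature.RingTheory.FittingIdeal.Module.fittingIdeal ↥B (Ω[↥B⁄S]) 0 →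
            (x : K) ∈ ca (tower O A m) := by
  intro k K _ _ _ O A _ _ _ _ _ m B hBfg hBic hdim hBT hfrac S _ _ _ hSB hinjS hnS x hx
  haveI : Algebra.FiniteType k ↥B := B.fg_iff_finiteType.mp hBfg
  have h4 : x ∈ cohomologyAnnihilatorOfDegree ↥B 4 := hJ k ↥B inferInstance hBic hdim S hinjS hSB hnS hx
  exact mem_ca_tower_of_mem_cohomologyAnnihilatorOfDegree O A m B hBfg hBT hfrac 4 x h4

end Summit.ResolutionOfSingularities.ResolutionOfSingularities.Theorems.NoZeno.JacobianFloor

end
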